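import Literature.NumberTheory.Automorphic.ArchRankOneJumpAllOrders          -- ★ FILE 4c (F0P3a-p09 (g6)): `exists_rankOne_jump_allOrders_of_eq_over` (Banach `E`)
import Literature.NumberTheory.Automorphic.ArchRankOneOrbitalVolumeWallBound  -- ★ p850846 (LH3-p01 (g4)): `coe_cayleyTorus_eq_smul`, `coe_conj_eq_smul_of_coe_eq_smul`
import HarnessLib

/-!
# THE ALL-ORDERS RANK-ONE JUMP RELATION, CENTRE-ONE READING: the torus curve `P t_1(ψ) P⁻¹` acting on `g`, the split side on `Y ↦ g(z⁻¹ • Y)`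
# (brick (JH-C2) of `JH-SPEC.v1.md` — the junction in the currency of ★ `exists_wallSet_representation(_normal)`; Shelstad 1979 Prop. 4.5, Bouaziz 1994 §3.2 (I₃), Varadarajan 1989 §6.4 Thm 24)

Topic `NumberTheory/Automorphic`; namespace `Literature.NumberTheory.Automorphic.UnitaryGroup`.  THEOREMS ONLY (no `def`, no instance, no notation, no axiom, no `sorry`).
Cell `pub/hodgecm-mathlib`, crux H413 (`stmt-HodgeConjecture-24833`), line LH3 (closer stub `stub_N9`, DIRECT ROAD), letter L3′ forward half = the jump clause (J) for `stOrbFamH`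
(JH-SPEC v1, LH3-p01 (g5), binder of record).  Count-neutral.

WHAT.  ★ FILE 4c states Harish-Chandra's all-orders jump on `U(J)` for the family `F_f(ψ) = 2 sin ψ • ∫ f(↑↑(h · P t_z(ψ) P⁻¹ · h⁻¹)) dν` with CENTRE `z = e^{iθ}` INSIDE the torus point and
the split functional `G` of the SAME `f`.  The wall-set representation of the stable family (★ p851224 ∕ p851323) carries the centre as a SCALAR on the matrix slot instead:
its functional is `ψ ↦ 2 sin ψ • ∫ g(↑↑(h · P t_1(ψ) P⁻¹ · h⁻¹)) dν` with `g = f ∘ (z • ·)` (★ `coe_cayleyTorus_eq_smul`: `↑↑(h · P t_z(ψ) P⁻¹ · h⁻¹) = z • ↑↑(h · P t_1(ψ) P⁻¹ · h⁻¹)`).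
**`exists_rankOne_jump_allOrders_centre_one_of_eq_over`**: 4c's constants `C₁, C₂ > 0` (same pins, stated for the record through 4c itself) such that for every `g ∈ C_c^∞(M₂(ℂ), E)`, `θ`,
every `F` with `F ψ = 2 sin ψ • ∫ g(↑↑(h · P t_1(ψ) P⁻¹ · h⁻¹)) dν`, every `G` continuous at `0` agreeing off `0` with `|eˣ − e⁻ˣ| • ∫_{U(J)⧸T} (g ∘ (e^{−iθ} • ·))(↑↑(y t_{x,θ} y⁻¹)) dμ`,
and every `k`: EVEN `∂^{2k} F → A^±` (`ψ → 0^±`) with `A⁺ − A⁻ = ((C₁∕C₂)(−1)^k) • ∂_x^{2k} G 0`; ODD: two-sided limit and `∂_x^{2k+1} G 0 = 0`.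
HONEST LABEL: HC_CM is proved only modulo the 7 printed citations (2 remaining: hLiu418 = stmt-HodgeConjecture-24832, h413 = stmt-HodgeConjecture-24833) until rung 0 closes; a
re-reading of ★ 4c, pays nothing by itself.

## References
* [Shelstad1979] D. Shelstad, *Characters and inner forms of a quasi-split group over ℝ*, Compositio Math. 39 (1979), Lemma 4.3 p. 25, Prop. 4.5 p. 26.
* [Bouaziz1994IntegralesOrbitales] A. Bouaziz, *Intégrales orbitales sur les groupes de Lie réductifs*, Ann. Sci. ÉNS 27 (1994), §3.2 (I₃) p. 580.
* [Varadarajan1989] V. S. Varadarajan, *An Introduction to Harmonic Analysis on Semisimple Lie Groups*, Cambridge Stud. Adv. Math. 16 (1989), §6.4 Thm 24.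
* [Rogawski1990] J. D. Rogawski, *Automorphic Representations of Unitary Groups in Three Variables*, Ann. of Math. Stud. 123 (1990), Prop. 8.2.1 p. 119.
-/

set_option autoImplicit false

noncomputable section

open MeasureTheory Measure Set Filter Topology Complex NumberField NumberField.InfinitePlace
open scoped ENNReal NNReal ComplexConjugate ContDiff Matrix.Norms.Operator MatrixGroups Real

namespace Literature.NumberTheory.Automorphic

open Literature.MeasureTheory.Group Literature.NumberTheory.Automorphic.Shelstad1979.StableOrbitalIntegrals

namespace UnitaryGroup

open Literature.NumberTheory.Rogawski1990
open Literature.NumberTheory.Automorphic.UnitaryGroup.HeisRing Literature.NumberTheory.Automorphic.UnitaryGroup.LineRing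

section Centre

variable (L : Type) [Field L] [NumberField L] (w : {w : InfinitePlace L // IsComplex w})
  {J : Matrix (Fin 2) (Fin 2) ℂ} (hJ : J = (StdForm.antidiagonal 2).over ℂ) [Fact (0 < 2 * π)]
  [MeasurableSpace ↥(unitaryGroupOfForm (starRingEnd ℂ) J)] [BorelSpace ↥(unitaryGroupOfForm (starRingEnd ℂ) J)]
  (ν : Measure ↥(unitaryGroupOfForm (starRingEnd ℂ) J)) [ν.IsHaarMeasure] [ν.IsMulRightInvariant]
  [MeasurableSpace (↥(unitaryGroupOfForm (starRingEnd ℂ) J) ⧸ torusU (starRingEnd ℂ) J)] [BorelSpace (↥(unitaryGroupOfForm (starRingEnd ℂ) J) ⧸ torusU (starRingEnd ℂ) J)]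
  (μ : Measure (↥(unitaryGroupOfForm (starRingEnd ℂ) J) ⧸ torusU (starRingEnd ℂ) J))
  [SMulInvariantMeasure ↥(unitaryGroupOfForm (starRingEnd ℂ) J) (↥(unitaryGroupOfForm (starRingEnd ℂ) J) ⧸ torusU (starRingEnd ℂ) J) μ] [IsFiniteMeasureOnCompacts μ]

include L w hJ in
/-- **THE ALL-ORDERS RANK-ONE JUMP RELATION, CENTRE-ONE READING.**  With ★ 4c's order-0 constants `C₁, C₂ > 0` (first two clauses = 4c's pins verbatim, for the record): for every
`g ∈ C_c^∞(M₂(ℂ), E)`, `θ : ℝ`, every `F : ℝ → E` with `F ψ = 2 sin ψ • ∫ g(↑↑(h · P t_1(ψ) P⁻¹ · h⁻¹)) dν` (centre ONE), every `G` continuous at `0` with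
`G x = |eˣ − e⁻ˣ| • ∫_{U(J)⧸T} (g ∘ (e^{−iθ} • ·))(↑↑(y t_{x,θ} y⁻¹)) dμ` for `x ≠ 0`, and every `k`: the even jets `∂^{2k} F` have one-sided limits at `0` differing by
`((C₁∕C₂)(−1)^k) • ∂_x^{2k} G 0`, the odd jets have a two-sided limit and `∂_x^{2k+1} G 0 = 0` (★ 4c at `f := g ∘ (e^{−iθ} • ·)`, `z := e^{iθ}`, ★ `coe_cayleyTorus_eq_smul`).
[cite: Shelstad1979, Prop. 4.5 p. 26] [cite: Bouaziz1994IntegralesOrbitales, §3.2 (I₃) p. 580] [cite: Varadarajan1989, §6.4 Thm 24] [cite: Rogawski1990, Prop. 8.2.1 p. 119] -/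
theorem exists_rankOne_jump_allOrders_centre_one_of_eq_over (hμ : μ ≠ 0) {E : Type*} [NormedAddCommGroup E] [NormedSpace ℝ E] [CompleteSpace E] :
    ∃ C₁ C₂ : ℝ, 0 < C₁ ∧ 0 < C₂ ∧
      ∀ (g : Matrix (Fin 2) (Fin 2) ℂ → E), ContDiff ℝ ∞ g → HasCompactSupport g → ∀ (θ : ℝ) (F : ℝ → E),
        (∀ ψ : ℝ, F ψ = (2 * Real.sin ψ) •
          ∫ h : ↥(unitaryGroupOfForm (starRingEnd ℂ) J), g (((h * (⟨(Matrix.GeneralLinearGroup.mkOfDetNeZero !![(1 : ℂ), 1; 1, -1] det_cayleyTwo_ne_zero) *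
              circleDiagonal 2 ![1 * Circle.exp ψ, 1 * Circle.exp (-ψ)] * ((Matrix.GeneralLinearGroup.mkOfDetNeZero !![(1 : ℂ), 1; 1, -1] det_cayleyTwo_ne_zero))⁻¹,
              cayley_conj_circleDiagonal_mem_of_eq_over hJ _⟩ : ↥(unitaryGroupOfForm (starRingEnd ℂ) J)) * h⁻¹ : ↥(unitaryGroupOfForm (starRingEnd ℂ) J)) : GL (Fin 2) ℂ) :
                Matrix (Fin 2) (Fin 2) ℂ) ∂ν) →
        ∀ (G : ℝ → E), ContinuousAt G 0 →
        (∀ x : ℝ, x ≠ 0 → G x = |Real.exp x - Real.exp (-x)| •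
          ∫ y, descConj (⟨hypBlockGL x θ, hypBlockGL_mem_of_eq_over hJ x θ⟩ : ↥(unitaryGroupOfForm (starRingEnd ℂ) J)) (torusU (starRingEnd ℂ) J)
            (LineRing.forall_mem_torusU_comm (starRingEnd ℂ) J (hypBlockGL_mem_torusU hJ x θ))
            (fun k : ↥(unitaryGroupOfForm (starRingEnd ℂ) J) => g ((((Circle.exp θ)⁻¹ : Circle) : ℂ) • ((k : GL (Fin 2) ℂ) : Matrix (Fin 2) (Fin 2) ℂ))) y ∂μ) →
        ∀ k : ℕ,
          (∃ Ap Am : E, Tendsto (fun ψ => iteratedDeriv (2 * k) F ψ) (𝓝[>] 0) (𝓝 Ap) ∧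
              Tendsto (fun ψ => iteratedDeriv (2 * k) F ψ) (𝓝[<] 0) (𝓝 Am) ∧
              Ap - Am = ((C₁ / C₂) * (-1 : ℝ) ^ k) • iteratedDeriv (2 * k) G 0) ∧
          (∃ A : E, Tendsto (fun ψ => iteratedDeriv (2 * k + 1) F ψ) (𝓝[>] 0) (𝓝 A) ∧
              Tendsto (fun ψ => iteratedDeriv (2 * k + 1) F ψ) (𝓝[<] 0) (𝓝 A) ∧
              iteratedDeriv (2 * k + 1) G 0 = 0) := by
  obtain ⟨C₁, C₂, hC₁, hC₂, -, -, h⟩ := exists_rankOne_jump_allOrders_of_eq_over L w hJ ν μ hμ (E := E)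
    (fun g Y => -(fderiv ℝ (fderiv ℝ g) Y (Y * !![0, I; I, 0]) (Y * !![0, I; I, 0]) + fderiv ℝ g Y (Y * !![0, I; I, 0] * !![0, I; I, 0])) +
        (fderiv ℝ (fderiv ℝ g) Y (Y * !![1, 0; 0, -1]) (Y * !![1, 0; 0, -1]) + fderiv ℝ g Y (Y * !![1, 0; 0, -1] * !![1, 0; 0, -1])) +
        (fderiv ℝ (fderiv ℝ g) Y (Y * !![0, I; -I, 0]) (Y * !![0, I; -I, 0]) + fderiv ℝ g Y (Y * !![0, I; -I, 0] * !![0, I; -I, 0])))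
    (fun _ _ => rfl)
  refine ⟨C₁, C₂, hC₁, hC₂, fun g hg hgc θ F hF G hG0 hG k => ?_⟩
  -- the scaled test function `f := g ∘ (e^{-iθ} • ·)` is `C_c^∞`
  set f : Matrix (Fin 2) (Fin 2) ℂ → E := fun Y => g ((((Circle.exp θ)⁻¹ : Circle) : ℂ) • Y) with hf_def
  have hf : ContDiff ℝ ∞ f := hg.comp (contDiff_const_smul _)
  have hfc : HasCompactSupport f := by
    rw [hf_def]
    exact hgc.comp_homeomorph ((Homeomorph.smulOfNeZero (((Circle.exp θ)⁻¹ : Circle) : ℂ) (Circle.coe_ne_zero _)))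
  -- the centre-`e^{iθ}` functional of `f` IS `F`
  have hFf : ∀ ψ : ℝ, F ψ = (2 * Real.sin ψ) •
      ∫ h : ↥(unitaryGroupOfForm (starRingEnd ℂ) J), f (((h * (⟨(Matrix.GeneralLinearGroup.mkOfDetNeZero !![(1 : ℂ), 1; 1, -1] det_cayleyTwo_ne_zero) *
          circleDiagonal 2 ![Circle.exp θ * Circle.exp ψ, Circle.exp θ * Circle.exp (-ψ)] * ((Matrix.GeneralLinearGroup.mkOfDetNeZero !![(1 : ℂ), 1; 1, -1] det_cayleyTwo_ne_zero))⁻¹,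
          cayley_conj_circleDiagonal_mem_of_eq_over hJ _⟩ : ↥(unitaryGroupOfForm (starRingEnd ℂ) J)) * h⁻¹ : ↥(unitaryGroupOfForm (starRingEnd ℂ) J)) : GL (Fin 2) ℂ) :
            Matrix (Fin 2) (Fin 2) ℂ) ∂ν := by
    intro ψ
    rw [hF ψ]
    congr 1
    refine integral_congr_ae (Eventually.of_forall fun h => ?_)
    rw [hf_def]
    simp only
    congr 1
    -- `e^{-iθ} • ↑↑(h · P t_{e^{iθ}}(ψ) P⁻¹ · h⁻¹) = ↑↑(h · P t_1(ψ) P⁻¹ · h⁻¹)`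
    have hc : (((h * (⟨(Matrix.GeneralLinearGroup.mkOfDetNeZero !![(1 : ℂ), 1; 1, -1] det_cayleyTwo_ne_zero) *
          circleDiagonal 2 ![Circle.exp θ * Circle.exp ψ, Circle.exp θ * Circle.exp (-ψ)] * ((Matrix.GeneralLinearGroup.mkOfDetNeZero !![(1 : ℂ), 1; 1, -1] det_cayleyTwo_ne_zero))⁻¹,
          cayley_conj_circleDiagonal_mem_of_eq_over hJ _⟩ : ↥(unitaryGroupOfForm (starRingEnd ℂ) J)) * h⁻¹ : ↥(unitaryGroupOfForm (starRingEnd ℂ) J)) : GL (Fin 2) ℂ) :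
            Matrix (Fin 2) (Fin 2) ℂ) =
        ((Circle.exp θ : Circle) : ℂ) • (((h * (⟨(Matrix.GeneralLinearGroup.mkOfDetNeZero !![(1 : ℂ), 1; 1, -1] det_cayleyTwo_ne_zero) *
          circleDiagonal 2 ![1 * Circle.exp ψ, 1 * Circle.exp (-ψ)] * ((Matrix.GeneralLinearGroup.mkOfDetNeZero !![(1 : ℂ), 1; 1, -1] det_cayleyTwo_ne_zero))⁻¹,
          cayley_conj_circleDiagonal_mem_of_eq_over hJ _⟩ : ↥(unitaryGroupOfForm (starRingEnd ℂ) J)) * h⁻¹ : ↥(unitaryGroupOfForm (starRingEnd ℂ) J)) : GL (Fin 2) ℂ) :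
            Matrix (Fin 2) (Fin 2) ℂ) :=
      coe_conj_eq_smul_of_coe_eq_smul (coe_cayleyTorus_eq_smul (Circle.exp θ) ψ)
    rw [hc, smul_smul, Circle.coe_inv, inv_mul_cancel₀ (Circle.coe_ne_zero _), one_smul]
  exact h f hf hfc θ (fun f' ψ => (2 * Real.sin ψ) •
      ∫ h : ↥(unitaryGroupOfForm (starRingEnd ℂ) J), f' (((h * (⟨(Matrix.GeneralLinearGroup.mkOfDetNeZero !![(1 : ℂ), 1; 1, -1] det_cayleyTwo_ne_zero) *
          circleDiagonal 2 ![Circle.exp θ * Circle.exp ψ, Circle.exp θ * Circle.exp (-ψ)] * ((Matrix.GeneralLinearGroup.mkOfDetNeZero !![(1 : ℂ), 1; 1, -1] det_cayleyTwo_ne_zero))⁻¹,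
          cayley_conj_circleDiagonal_mem_of_eq_over hJ _⟩ : ↥(unitaryGroupOfForm (starRingEnd ℂ) J)) * h⁻¹ : ↥(unitaryGroupOfForm (starRingEnd ℂ) J)) : GL (Fin 2) ℂ) :
            Matrix (Fin 2) (Fin 2) ℂ) ∂ν)
    (fun _ _ => rfl) G hG0 hG k |>.imp (fun ⟨Ap, Am, h1, h2, h3⟩ => ⟨Ap, Am, by simpa only [← funext hFf] using h1, by simpa only [← funext hFf] using h2, h3⟩)
      (fun ⟨A, h1, h2, h3⟩ => ⟨A, by simpa only [← funext hFf] using h1, by simpa only [← funext hFf] using h2, h3⟩)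

end Centre

end UnitaryGroup

end Literature.NumberTheory.Automorphic

end
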